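import Literature.Computability.Cryptography.LWEPrimePowerProgQuery
import Literature.Computability.Cryptography.LWEPrimePowerProgDigBridge
import Literature.Computability.Cryptography.LWEPrimePowerProgHistBridge
import HarnessLib

/-!
# The Micciancio–Peikert machine, VI′: the list-level query of a round IS the strategy's query

Topic `Computability/Cryptography` (LWE), grouping namespace `LWE.MP12.Prog`, bridge between
`LWEPrimePowerProgQuery.lean` (`queryOfL`) and `LWEPrimePowerStrategy.queryOf`. Proved material (no
named fact) towards `Literature.Computability.Cryptography.blprs_gapSVP_sqrt_dim_to_lwe_classical`
(**pqc.S21**), hypothesis `h₂`: on a genuine input and for every round `idx = |history| < nCalls`,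
**`queryOfL_eq`**: the list-level query is the list form of `queryOf (1/G) (layout (S, coins)) history idx`
paired with the list of its coin slice.

## References

* D. Micciancio, C. Peikert, *Trapdoors for lattices: simpler, tighter, faster, smaller*, EUROCRYPT 2012,
  LNCS 7237; full version IACR ePrint 2011/501, §3, Thm. 3.1 proof (pp. 15–16). [MicciancioPeikert2012]
-/

noncomputable section

namespace Literature.Computability.Cryptography

namespace LWE

namespace MP12

namespace Prog

open _root_.Computability Literature.Computability.Complexity Finset

section Bridge

variable {d e K' m N T N' m' ℓ G : ℕ}
variable (S : Fin (numSamples d e K' m N T N' m') → (Fin d → ZMod (2 ^ e)) × ZMod (2 ^ e)) (r bits : List Bool)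

/-- The unary copies of the genuine input. [folklore] -/
def Uof (d e K' m N T N' : ℕ) : UnT := (d, (K' + 1, (e, (m, (T, (N, N'))))))

/-- The genuine round context. [folklore] -/
def qCtxOf : QCtx := ((Pof d e K' m N T N' m' ℓ G, Uof d e K' m N T N'), (List.ofFn fun i => toItem (S i), (r, bits)))

variable {S r bits}

/-- **The mixed-radix decoding is the inverse of the digit position.** [folklore] -/
theorem digDecode_eq (r₀ : ℕ) (h : r₀ < nDig d e 2 T N) :
    digDecode (Pof d e K' m N T N' m' ℓ G) r₀ =
      (((digEquiv d e 2 T N).symm ⟨r₀, h⟩).1.val, (((digEquiv d e 2 T N).symm ⟨r₀, h⟩).2.1.val, (((digEquiv d e 2 T N).symm ⟨r₀, h⟩).2.2.1.val,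
        (((digEquiv d e 2 T N).symm ⟨r₀, h⟩).2.2.2.1.val, (((digEquiv d e 2 T N).symm ⟨r₀, h⟩).2.2.2.2.1.val,
          ((digEquiv d e 2 T N).symm ⟨r₀, h⟩).2.2.2.2.2.val))))) := by
  -- the radices are positive
  have hpos : 0 < d * (e * (2 * (T * (2 * N)))) := lt_of_le_of_lt (Nat.zero_le _) h
  have hN : 0 < N := Nat.pos_of_ne_zero fun h0 => by simp [h0] at hpos
  have hT : 0 < T := Nat.pos_of_ne_zero fun h0 => by simp [h0] at hpos
  have he : 0 < e := Nat.pos_of_ne_zero fun h0 => by simp [h0] at hpos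
  set PP := 2 * (T * (2 * N)) with hPP
  have hPPpos : 0 < PP := by positivity
  have h2N : 0 < 2 * N := by positivity
  have hT2N : 0 < T * (2 * N) := by positivity
  set r₁ := r₀ % (e * PP) with hr₁
  set r₂ := r₁ % PP with hr₂
  set r₃ := r₂ % (T * (2 * N)) with hr₃
  set r₄ := r₃ % (2 * N) with hr₄
  have h' : r₀ < d * (e * PP) := h
  have hc : r₀ / (e * PP) < d := Nat.div_lt_of_lt_mul (by rw [Nat.mul_comm]; exact h')
  have hi' : r₁ / PP < e := Nat.div_lt_of_lt_mul (by rw [Nat.mul_comm]; exact Nat.mod_lt _ (by positivity))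
  have hk : r₂ / (T * (2 * N)) < 2 := Nat.div_lt_of_lt_mul (by rw [Nat.mul_comm]; exact Nat.mod_lt _ hPPpos)
  have ht : r₃ / (2 * N) < T := Nat.div_lt_of_lt_mul (by rw [Nat.mul_comm]; exact Nat.mod_lt _ hT2N)
  have hh : r₄ / N < 2 := Nat.div_lt_of_lt_mul (by rw [Nat.mul_comm]; exact Nat.mod_lt _ h2N)
  have hb : r₄ % N < N := Nat.mod_lt _ hN
  set y : DigIdx d e 2 T N := (⟨_, hc⟩, (⟨_, hi'⟩, (⟨_, hk⟩, (⟨_, ht⟩, (⟨_, hh⟩, ⟨_, hb⟩))))) with hy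
  have hval : digEquiv d e 2 T N y = ⟨r₀, h⟩ := by
    apply Fin.ext
    rw [val_digEquiv]
    simp only [hy]
    have e1 := Nat.div_add_mod' r₀ (e * PP)
    have e2 := Nat.div_add_mod' r₁ PP
    have e3 := Nat.div_add_mod' r₂ (T * (2 * N))
    have e4 := Nat.div_add_mod' r₃ (2 * N)
    have e5 := Nat.div_add_mod' r₄ N
    rw [← hr₁] at e1; rw [← hr₂] at e2; rw [← hr₃] at e3; rw [← hr₄] at e4
    have e1' : r₀ / (e * PP) * (e * (2 * (T * (2 * N)))) = r₀ / (e * PP) * (e * PP) := by rw [hPP]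
    have e2' : r₁ / PP * (2 * (T * (2 * N))) = r₁ / PP * PP := by rw [hPP]
    omega
  have hx : (digEquiv d e 2 T N).symm ⟨r₀, h⟩ = y := (Equiv.symm_apply_eq _).2 hval.symm
  rw [hx]
  simp only [digDecode, Pof, PrmT.e, PrmT.T, PrmT.N, hy]
  rfl

/-- Unfolding `queryOfL` on the genuine context. [folklore] -/
theorem queryOfL_qCtxOf :
    queryOfL (qCtxOf (ℓ := ℓ) (G := G) S r bits) =
      if decide (bits.length < nEst e N') then
        estQueryL (Pof d e K' m N T N' m' ℓ G) d (K' + 1) e (List.ofFn fun i => toItem (S i)) r (bits.length / N') (bits.length % N')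
      else
        let D := digDecode (Pof d e K' m N T N' m' ℓ G) (bits.length - nEst e N')
        digQueryL (((Pof d e K' m N T N' m' ℓ G), (d, (m, e))), (List.ofFn fun i => toItem (S i), (r,
          (D.1, (D.2.1, (D.2.2.1, (D.2.2.2.1, (D.2.2.2.2.1, (D.2.2.2.2.2, (stepOfL bits e N', LstateL bits (Hof e T N N' G) T e D.1 D.2.1)))))))))) := rfl

/-- **The list-level query of round `idx = |history| < nCalls` is the strategy's query.**
[cite: MicciancioPeikert2012, Thm. 3.1 proof (pp. 15–16)] -/
theorem queryOfL_eq (hr : numCoins d e m N T N' ℓ ≤ r.length) (hG : 1 ≤ G) (hidx : bits.length < nCalls d e 2 T N N') :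
    queryOfL (qCtxOf (ℓ := ℓ) (G := G) S r bits) =
      (toLData (queryOf (K' := K') (1 / (G : ℝ)) (layout d e K' m N T N' m' ℓ (S, coinsOf d e m N T N' ℓ r)) bits bits.length).1,
        List.ofFn (queryOf (K' := K') (1 / (G : ℝ)) (layout d e K' m N T N' m' ℓ (S, coinsOf d e m N T N' ℓ r)) bits bits.length).2) := by
  rw [queryOf, queryOfL_qCtxOf]
  by_cases hi : bits.length < nEst e N'
  · rw [dif_pos hi, if_pos (decide_eq_true hi)]
    set jk := finProdFinEquiv.symm (⟨bits.length, hi⟩ : Fin ((e + 1) * N')) with hjk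
    have hj : jk.1.val = bits.length / N' := by rw [hjk, finProdFinEquiv_symm_apply]; simp [Fin.coe_divNat]
    have hk : jk.2.val = bits.length % N' := by rw [hjk, finProdFinEquiv_symm_apply]; simp [Fin.coe_modNat]
    have h := estQueryL_eq (m' := m') (G := G) (S := S) hr jk.1 jk.2
    rw [hj, hk] at h
    rw [h]
    simp only [hj]
  · rw [dif_neg hi, if_neg (by simpa using hi)]
    have hi2 : bits.length - nEst e N' < nDig d e 2 T N := by unfold nCalls at hidx; omega
    rw [dif_pos hi2]
    set x := (digEquiv d e 2 T N).symm ⟨bits.length - nEst e N', hi2⟩ with hx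
    have hdec := digDecode_eq (K' := K') (m := m) (N' := N') (m' := m') (ℓ := ℓ) (G := G) (bits.length - nEst e N') hi2
    rw [← hx] at hdec
    rw [hdec]
    show digQueryL (digCtxOf (ℓ := ℓ) (G := G) S r x.1 x.2.1 x.2.2.1 x.2.2.2.1 x.2.2.2.2.1 x.2.2.2.2.2 (stepOfL bits e N')
      (LstateL bits (Hof e T N N' G) T e x.1.val x.2.1.val)) = _
    rw [digQueryL_eq hr, stepOfL_eq, LstateL_eq (T := T) (N := N) (N' := N') bits hG x.1 x.2.1.val, stepOf]

end Bridge

end Prog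

end MP12

end LWE

end Literature.Computability.Cryptography

end
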